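import Literature.AlgebraicGeometry.Modules.PullbackPushforwardTwist
import HarnessLib

/-!
# The base-change morphism `b^* p_* G ⟶ p_{T*} pr^* G` of a commutative square, and its value on pulled-back sections

[Hartshorne1977] III Prop. 9.3 and its proof / [StacksProject, Tag 02N6] (base change map): for a commutative square
of schemes
```
X_T —pr→ X
 |pT       |p
 T  ——b——→ S        `pr ≫ p = pT ≫ b`
```
and an `𝒪_X`-module `G` there is a natural morphism `b^* p_* G ⟶ p_{T*} pr^* G` — «the base change map», an
isomorphism under flatness (III 9.3) or under cohomology-and-base-change hypotheses (III 12.11) — defined as the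
transpose across `pT^* ⊣ pT_*` of `pT^* b^* p_* G = pr^* p^* p_* G ⟶ pr^* G` (pull-back of the counit `p^* p_* ⟶ 𝟭`).

Mathlib's `Scheme.Modules.pullback` is abstract (a left adjoint); the tree computes with it through PULLED-BACK
SECTIONS `η(m)` (★ `Modules/PullbackUnitSections.unitSection`, ★ `Modules/PullbackAffineChart.unitSectionLE`).  THIS FILE
defines, for ANY commutative square (no cartesian hypothesis is needed for the definition):

* `pushforwardBaseChangeCounit w G : pT^*(b^*(p_* G)) ⟶ pr^* G` — `pullbackComp ≫ pullbackCongr ≫ pullbackComp⁻¹ ≫ pr^*(ε_G)`;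
* `pushforwardBaseChangeHom w G : b^*(p_* G) ⟶ pT_*(pr^* G)` — its transpose (`η_{pT} ≫ pT_*(…)`);

and proves naturality in `G` (`pushforwardBaseChangeCounit_naturality`, `pushforwardBaseChangeHom_naturality`), the
transpose identity `pushforwardBaseChangeHom_eq`, and the SECTION FORMULAS
`pushforwardBaseChangeCounit_app_unitSection` («`η_{pT}(η_b(s)) ↦ η_{pr}(s)`») and
**`pushforwardBaseChangeHom_app_unitSectionLE`** («`η_b(s)|_W ↦ η_{pr}(s)|_{pT⁻¹W}`» for `s ∈ Γ(G, p⁻¹V)`, `W ⊆ b⁻¹V`) —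
the formula through which `IsIso`/`Mono` of the base-change map is read on affine charts
(★ `Modules/PullbackSectionsBaseChange`, ★ `Modules/IsoOfSectionsOnBasis`).

Two definitions, the rest theorems; no named fact, no `sorry`, no instance.  Cell hodgecm-mathlib, F-DAG second wave
(h6-d) FILE A (the (hbc) socket «`p_*𝒪_X(n)` commutes with base change» is `IsIso (pushforwardBaseChangeHom …)`);
consumer FILE B `Morphisms/ContainmentRepOfPushforward`.  HC_CM is proved only modulo the printed citations until rung 0
closes; this file discharges none of them.

## References
* [Hartshorne1977] R. Hartshorne, *Algebraic Geometry* (1977), II §5 p. 110 (`f^*`, `f_*`, adjunction), III Prop. 9.3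
  (the base change morphism `u^* f_* ℱ → g_* v^* ℱ`, Remark 9.3.1), III Thm. 12.11.
* [StacksProject] The Stacks Project, Tag 02N6 (base change map `g^* f_* ℱ → f'_* (g')^* ℱ`), Tag 01CB.
-/

noncomputable section

-- `TopCat.Presheaf`/`Scheme.Modules` are not reducible (as in Mathlib's `AlgebraicGeometry/Modules/Sheaf.lean`).
set_option backward.isDefEq.respectTransparency false

open CategoryTheory CategoryTheory.Limits AlgebraicGeometry TopologicalSpace Opposite

universe u

namespace Literature.AlgebraicGeometry.Modules

section BaseChange

variable {X S T XT : Scheme.{u}} {pr : XT ⟶ X} {pT : XT ⟶ T} {p : X ⟶ S} {b : T ⟶ S} (w : pr ≫ p = pT ≫ b)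

/-- **The base-change counit** `pT^*(b^*(p_* G)) ⟶ pr^* G`: `pT^* b^* = (pT ≫ b)^* = (pr ≫ p)^* = pr^* p^*` (Mathlib
`pullbackComp`, `pullbackCongr`) followed by `pr^*` of the counit `ε_G : p^* p_* G ⟶ G`.
[cite: Hartshorne1977, III Prop. 9.3 (Remark 9.3.1)] [cite: StacksProject, Tag 02N6] -/
def pushforwardBaseChangeCounit (G : X.Modules) :
    (Scheme.Modules.pullback pT).obj ((Scheme.Modules.pullback b).obj ((Scheme.Modules.pushforward p).obj G)) ⟶
      (Scheme.Modules.pullback pr).obj G :=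
  (Scheme.Modules.pullbackComp pT b).hom.app _ ≫ (Scheme.Modules.pullbackCongr w.symm).hom.app _ ≫
    (Scheme.Modules.pullbackComp pr p).inv.app _ ≫
      (Scheme.Modules.pullback pr).map ((Scheme.Modules.pullbackPushforwardAdjunction p).counit.app G)

/-- **The base-change morphism** `b^*(p_* G) ⟶ pT_*(pr^* G)` ([Hartshorne1977] III 9.3.1; [StacksProject, Tag 02N6]):
the transpose of `pushforwardBaseChangeCounit` across Mathlib's adjunction `pT^* ⊣ pT_*`.
[cite: Hartshorne1977, III Prop. 9.3 (Remark 9.3.1)] [cite: StacksProject, Tag 02N6] -/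
def pushforwardBaseChangeHom (G : X.Modules) :
    (Scheme.Modules.pullback b).obj ((Scheme.Modules.pushforward p).obj G) ⟶
      (Scheme.Modules.pushforward pT).obj ((Scheme.Modules.pullback pr).obj G) :=
  (Scheme.Modules.pullbackPushforwardAdjunction pT).homEquiv _ _ (pushforwardBaseChangeCounit w G)

/-- The base-change morphism is `η_{pT} ≫ pT_*(base-change counit)`. [cite: Hartshorne1977, II §5 p. 110] -/
theorem pushforwardBaseChangeHom_eq (G : X.Modules) :
    pushforwardBaseChangeHom w G = (Scheme.Modules.pullbackPushforwardAdjunction pT).unit.app _ ≫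
      (Scheme.Modules.pushforward pT).map (pushforwardBaseChangeCounit w G) := by
  rw [pushforwardBaseChangeHom, Adjunction.homEquiv_unit]

/-- Transposing back: `pT^*(pushforwardBaseChangeHom) ≫ ε = pushforwardBaseChangeCounit`.
[cite: Hartshorne1977, II §5 p. 110] -/
theorem pushforwardBaseChangeHom_counit (G : X.Modules) :
    (Scheme.Modules.pullback pT).map (pushforwardBaseChangeHom w G) ≫
      (Scheme.Modules.pullbackPushforwardAdjunction pT).counit.app _ = pushforwardBaseChangeCounit w G := by
  have h : ((Scheme.Modules.pullbackPushforwardAdjunction pT).homEquiv _ _).symm (pushforwardBaseChangeHom w G) =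
      pushforwardBaseChangeCounit w G := by
    rw [pushforwardBaseChangeHom, Equiv.symm_apply_apply]
  rw [Adjunction.homEquiv_counit] at h
  exact h

/-- **Naturality of the base-change counit in the module**: for `φ : F ⟶ G`,
`pT^*(b^*(p_*φ)) ≫ c_G = c_F ≫ pr^*φ` (naturality of `pullbackComp`, `pullbackCongr` and of the counit).
[cite: Hartshorne1977, III Prop. 9.3 (Remark 9.3.1)] -/
theorem pushforwardBaseChangeCounit_naturality {F G : X.Modules} (φ : F ⟶ G) :
    (Scheme.Modules.pullback pT).map ((Scheme.Modules.pullback b).map ((Scheme.Modules.pushforward p).map φ)) ≫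
        pushforwardBaseChangeCounit w G =
      pushforwardBaseChangeCounit w F ≫ (Scheme.Modules.pullback pr).map φ := by
  have h₁ := (Scheme.Modules.pullbackComp pT b).hom.naturality ((Scheme.Modules.pushforward p).map φ)
  have h₂ := (Scheme.Modules.pullbackCongr w.symm).hom.naturality ((Scheme.Modules.pushforward p).map φ)
  have h₃ := (Scheme.Modules.pullbackComp pr p).inv.naturality ((Scheme.Modules.pushforward p).map φ)
  have h₄ := (Scheme.Modules.pullbackPushforwardAdjunction p).counit.naturality φ
  simp only [Functor.comp_map, Functor.id_map] at h₁ h₂ h₃ h₄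
  simp only [pushforwardBaseChangeCounit, Category.assoc]
  rw [← Functor.map_comp, ← h₄, Functor.map_comp]
  erw [reassoc_of% h₁, reassoc_of% h₂, reassoc_of% h₃]

/-- **Naturality of the base-change morphism in the module**: for `φ : F ⟶ G`,
`b^*(p_*φ) ≫ β_G = β_F ≫ pT_*(pr^*φ)`. [cite: Hartshorne1977, III Prop. 9.3 (Remark 9.3.1)] [cite: StacksProject, Tag 02N6] -/
theorem pushforwardBaseChangeHom_naturality {F G : X.Modules} (φ : F ⟶ G) :
    (Scheme.Modules.pullback b).map ((Scheme.Modules.pushforward p).map φ) ≫ pushforwardBaseChangeHom w G =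
      pushforwardBaseChangeHom w F ≫
        (Scheme.Modules.pushforward pT).map ((Scheme.Modules.pullback pr).map φ) := by
  rw [pushforwardBaseChangeHom, pushforwardBaseChangeHom, ← Adjunction.homEquiv_naturality_left,
    ← Adjunction.homEquiv_naturality_right, pushforwardBaseChangeCounit_naturality]

/-! ### Section formulas -/

include w in
/-- The two ways round the square give the same preimage of an open of `S`. [cite: Hartshorne1977, III Prop. 9.3 (Remark 9.3.1)] -/
theorem preimage_preimage_eq_of_sq (V : S.Opens) : pr ⁻¹ᵁ (p ⁻¹ᵁ V) = pT ⁻¹ᵁ (b ⁻¹ᵁ V) := by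
  rw [← Scheme.Hom.comp_preimage, ← Scheme.Hom.comp_preimage, w]

set_option maxHeartbeats 400000 in
/-- **The base-change counit on pulled-back sections**: `η_{pT}(η_b(s)) ↦ η_{pr}(s)` for `s ∈ Γ(p_*G, V) = Γ(G, p⁻¹V)`
(up to the identification of opens `pT⁻¹b⁻¹V = pr⁻¹p⁻¹V`). [cite: Hartshorne1977, II §5 p. 110] [cite: StacksProject, Tag 02N6] -/
theorem pushforwardBaseChangeCounit_app_unitSection (G : X.Modules) (V : S.Opens)
    (s : Γ((Scheme.Modules.pushforward p).obj G, V)) :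
    (pushforwardBaseChangeCounit w G).app (pT ⁻¹ᵁ (b ⁻¹ᵁ V))
        (unitSection pT ((Scheme.Modules.pullback b).obj ((Scheme.Modules.pushforward p).obj G)) (b ⁻¹ᵁ V)
          (unitSection b ((Scheme.Modules.pushforward p).obj G) V s)) =
      ((Scheme.Modules.pullback pr).obj G).presheaf.map (eqToHom (preimage_preimage_eq_of_sq w V).symm).op
        (unitSection pr G (p ⁻¹ᵁ V) (show Γ(G, p ⁻¹ᵁ V) from s)) := by
  simp only [pushforwardBaseChangeCounit, Scheme.Modules.Hom.comp_app, CategoryTheory.comp_apply]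
  have h1 := pullbackComp_hom_app_unitSection b ((Scheme.Modules.pushforward p).obj G) pT V s
  have h2 := pullbackCongr_hom_app_unitSection (M := (Scheme.Modules.pushforward p).obj G) w.symm V s
  have h3 := pullbackComp_inv_app_unitSection p ((Scheme.Modules.pushforward p).obj G) pr V s
  have h4 := pullback_map_app_unitSection pr ((Scheme.Modules.pullbackPushforwardAdjunction p).counit.app G)
    (p ⁻¹ᵁ V) (unitSection p ((Scheme.Modules.pushforward p).obj G) V s)
  rw [counit_app_unitSection] at h4
  erw [h1, h2, app_presheaf_map, app_presheaf_map, h3, h4]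
  rfl

/-- **The base-change morphism on pulled-back sections**: `η_b(s) ↦ η_{pr}(s)` for `s ∈ Γ(p_*G, V) = Γ(G, p⁻¹V)`, as
sections of `pT_*(pr^*G)` over `b⁻¹V`, i.e. of `pr^*G` over `pT⁻¹b⁻¹V = pr⁻¹p⁻¹V`.
[cite: Hartshorne1977, III Prop. 9.3 (Remark 9.3.1)] [cite: StacksProject, Tag 02N6] -/
theorem pushforwardBaseChangeHom_app_unitSection (G : X.Modules) (V : S.Opens)
    (s : Γ((Scheme.Modules.pushforward p).obj G, V)) :
    (pushforwardBaseChangeHom w G).app (b ⁻¹ᵁ V) (unitSection b ((Scheme.Modules.pushforward p).obj G) V s) =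
      ((Scheme.Modules.pullback pr).obj G).presheaf.map (eqToHom (preimage_preimage_eq_of_sq w V).symm).op
        (unitSection pr G (p ⁻¹ᵁ V) (show Γ(G, p ⁻¹ᵁ V) from s)) := by
  rw [pushforwardBaseChangeHom_eq, Scheme.Modules.Hom.comp_app, CategoryTheory.comp_apply,
    Scheme.Modules.pushforward_map_app]
  exact pushforwardBaseChangeCounit_app_unitSection w G V s

/-- **The base-change morphism on restricted pulled-back sections** — the working formula: for `W ⊆ b⁻¹V` and
`s ∈ Γ(G, p⁻¹V)`, `β(η_b(s)|_W) = η_{pr}(s)|_{pT⁻¹W}` (a section of `pT_*(pr^*G)` over `W`).  On an affine chart this says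
that `β` is `t ⊗ s ↦ t · η_{pr}(s)|` under ★ `Modules/PullbackSectionsBaseChange.exists_linearEquiv_tensor_sections_pullback`.
[cite: Hartshorne1977, III Prop. 9.3 (Remark 9.3.1)] [cite: StacksProject, Tag 02N6] -/
theorem pushforwardBaseChangeHom_app_unitSectionLE (G : X.Modules) {V : S.Opens} {W : T.Opens} (i : W ≤ b ⁻¹ᵁ V)
    (s : Γ(G, p ⁻¹ᵁ V)) :
    (pushforwardBaseChangeHom w G).app W
        (unitSectionLE b ((Scheme.Modules.pushforward p).obj G) i
          (show Γ((Scheme.Modules.pushforward p).obj G, V) from s)) =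
      unitSectionLE pr G
        ((Scheme.Hom.preimage_mono pT i).trans (preimage_preimage_eq_of_sq w V).ge) s := by
  simp only [unitSectionLE]
  rw [app_presheaf_map, pushforwardBaseChangeHom_app_unitSection]
  change ((Scheme.Modules.pullback pr).obj G).presheaf.map _
      (((Scheme.Modules.pullback pr).obj G).presheaf.map _ (unitSection pr G (p ⁻¹ᵁ V) s)) = _
  rw [← CategoryTheory.comp_apply, ← Functor.map_comp]
  rfl

end BaseChange

end Literature.AlgebraicGeometry.Modules

end
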